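import Mathlib
import Literature.NumberTheory.LFunctions.Zhang2022.AppendixBLemma151ReductionLemmas
import Literature.NumberTheory.EllipticCurves.HeckeTnGamma0Explicit
import HarnessLib

/-!
# Zhang (2022), App. B, proof of Lemma 15.1: the reduction to one-variable `ϰ_μ`-sums for a
# general multiplicative weight (GAP-LEDGER rows G-d50-1 / G-L4t6-1; core of part 2)

Topic `Literature/NumberTheory/LFunctions/Zhang2022` (Landau–Siegel audit tree; verdict-neutral).
Y. Zhang, arXiv:2211.02515v1 (2022) [Zhang2022LandauSiegel] — an unrefereed manuscript under
adjudication; nothing here bears on its Theorems 1–2. Node `Z22:Lem15.1.pf` [Z22 pp.106–107,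
tex L5248–L5286]: print never writes down how `b = f ∗ g` ((12.2)/(15.1); `f = ϰ₁·[·<P^{1/2}] + ι₂ϰ₂`,
`g = ῑ₃ϰ₃ + ῑ₄ϰ₂`, the banked `Skeleton.bcoef`) and the multiplicativity of the weight `ϱ*_j`
(15.21) reduce `Σ_{(n,𝔮)=1} b(n₁n)ϱ*_j(n)/n` to products of one-variable sums; the same step is used
silently at §17.u023 with the weight `κ̄₂ = μ·ϱ₁` (GAP row G-L4t6-1). PROVED here for ANY weight
`ρ` multiplicative on coprime pairs with `|ρ| ≤ τ₂` (`bcoef_weight_reduction_at`): with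
`R = {1 ≤ n < ⌈P⌉ : (n,𝔮) = 1}`, `n₁ ∈ 𝔫(𝔮)`, `𝓛 ≥ 3`,
`‖Σ_{n∈R} b(n₁n)ρ(n)/n − Σ_{d₁d₂=n₁}(Σ_{u∈R} f(d₁u)ρ(u)/u)(Σ_{v∈R} g(d₂v)ρ(v)/v)‖
 ≤ (1+|ι₂|)(|ι₃|+|ι₄|)·16(Σ_{m<⌈P⌉}1/m)⁴/D⁴·τ₂(n₁)`.
Mechanism (0 facts): `(n₁,n) = 1`, so divisor pairs of `n₁n` = products of those of `n₁`, `n`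
(tree `ModularForms.UpperHecke.sum_divisorsAntidiagonal_mul_of_coprime`); no pair is lost to
`n < ⌈P⌉` since `f(d₁u) ≠ 0 ⇒ u < P^{1/2}`, `g(d₂v) ≠ 0 ⇒ v < max(P₂,P₃)`, `P^{1/2}max(P₂,P₃) < P`;
the difference to the product form lives on pairs sharing a prime `q ≥ D⁴` (`common_prime_tail_le`).
The instances `ρ = ϱ*_j` (`lemma151_hdec…`) are in `AppendixBLemma151Reduction`.
[cite: Zhang2022LandauSiegel, App. B, proof of Lemma 15.1]
-/

noncomputable section

open Complex Real ComplexConjugate Finset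

namespace Literature.NumberTheory.LFunctions.Zhang2022.Skeleton


/-! ## §4. Supports: `f(a) ≠ 0 ⇒ a < P^{1/2}`, `g(c) ≠ 0 ⇒ c < max(P₂,P₃)`, `P^{1/2}max(P₂,P₃) < P` -/

section Support

variable {D : ℕ}

/-- `f(a) = ϰ₁(a)[a < P^{1/2}] + ι₂ϰ₂(a) ≠ 0 ⇒ a < P^{1/2}` (`P₂ ≤ P^{1/2}`).
[cite: Zhang2022LandauSiegel, §15 (15.2)] -/
private theorem lt_sqrtP_of_ne_zero {a : ℕ}
    (h : (if (a : ℝ) < bigP D ^ (1 / 2 : ℝ) then vk1 D a else 0) + iota2 * vk2 D a ≠ 0) :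
    (a : ℝ) < bigP D ^ (1 / 2 : ℝ) := by
  by_contra hge
  rw [not_lt] at hge
  apply h
  have hP2 : P2 D ≤ a := by
    refine le_trans ?_ hge
    have hT : 1 ≤ bigT D ^ 10 :=
      one_le_pow₀ (Real.one_le_exp (Real.rpow_nonneg (Real.log_natCast_nonneg D) _))
    rw [P2, show (0.5 : ℝ) = 1 / 2 by norm_num]
    exact div_le_self (Real.rpow_nonneg (Real.exp_pos _).le _) hT
  rw [if_neg (not_lt.mpr hge), vk2_eq_zero hP2]
  simp

/-- `g(c) = ῑ₃ϰ₃(c) + ῑ₄ϰ₂(c) ≠ 0 ⇒ c < max(P₂,P₃)`. [cite: Zhang2022LandauSiegel, §15 (15.2)] -/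
private theorem lt_max_of_ne_zero {c : ℕ} (h : conj iota3 * vk3 D c + conj iota4 * vk2 D c ≠ 0) :
    (c : ℝ) < max (P2 D) (P3 D) := by
  by_contra hge
  rw [not_lt] at hge
  apply h
  rw [vk3_eq_zero (le_trans (le_max_right _ _) hge), vk2_eq_zero (le_trans (le_max_left _ _) hge)]
  simp

/-- `P^{1/2}·max(P₂,P₃) < P` once `𝓛 ≥ 3` (`P^{1/2}P₂ = PT⁻¹⁰`, `P^{1/2}P₃ = P^{0.998}`).
[cite: Zhang2022LandauSiegel, §15 (15.2)] -/
private theorem sqrtP_mul_max_lt_bigP (hD : 3 ≤ ell D) :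
    bigP D ^ (1 / 2 : ℝ) * max (P2 D) (P3 D) < bigP D := by
  have hℓ0 : 0 < ell D := by linarith
  have hP : 0 < bigP D := Real.exp_pos _
  have hP1 : 1 < bigP D := by
    rw [bigP]; exact Real.one_lt_exp_iff.mpr (by positivity)
  have hT1 : 1 < bigT D := by
    rw [bigT]; exact Real.one_lt_exp_iff.mpr (by positivity)
  have hsqrt : bigP D ^ (1 / 2 : ℝ) * bigP D ^ (1 / 2 : ℝ) = bigP D := by
    rw [← Real.rpow_add hP]; norm_num
  rcases le_total (P3 D) (P2 D) with h32 | h23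
  · rw [max_eq_left h32, P2, show (0.5 : ℝ) = 1 / 2 by norm_num, mul_div_assoc', hsqrt]
    exact div_lt_self hP (one_lt_pow₀ hT1 (by norm_num))
  · rw [max_eq_right h23, P3, ← Real.rpow_add hP]
    calc bigP D ^ (1 / 2 + 0.498 : ℝ) < bigP D ^ (1 : ℝ) :=
          Real.rpow_lt_rpow_of_exponent_lt hP1 (by norm_num)
      _ = bigP D := Real.rpow_one _

end Support

/-! ## §5. The reduction for a general weight -/

section Reduction

variable {D : ℕ}

/-- `τ₂(uv) ≤ τ₂(u)τ₂(v)`. [folklore] -/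
private theorem card_divisors_mul_le' (u v : ℕ) :
    (u * v).divisors.card ≤ u.divisors.card * v.divisors.card := by
  rw [Nat.divisors_mul]; exact Finset.card_mul_le

/-- For a weight with `|ρ| ≤ τ₂`: `|ρ(uv) − ρ(u)ρ(v)| ≤ 2τ₂(u)τ₂(v)`. [cite: Zhang2022LandauSiegel, App. B p.106] -/
private theorem norm_weight_mul_sub_le (ρ : ℕ → ℂ) (hρle : ∀ n : ℕ, ‖ρ n‖ ≤ n.divisors.card)
    (u v : ℕ) : ‖ρ (u * v) - ρ u * ρ v‖ ≤ 2 * ((u.divisors.card : ℝ) * v.divisors.card) := by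
  refine (norm_sub_le _ _).trans ?_
  rw [norm_mul, two_mul]
  refine add_le_add ((hρle _).trans ?_) ?_
  · exact_mod_cast card_divisors_mul_le' u v
  · exact mul_le_mul (hρle u) (hρle v) (norm_nonneg _) (Nat.cast_nonneg _)

/-- **The reduction at a fixed modulus, for a general weight** `ρ` which is multiplicative on
coprime pairs with `|ρ| ≤ τ₂` (the core of G-d50-1 with `ρ = ϱ*_j`; the same statement serves the
§17.u023 variant of Lemma 15.1 with `ρ = μ·ϱ₁`, GAP row G-L4t6-1): for `𝓛 ≥ 3` and `n₁ ∈ 𝔫(𝔮)`,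
`‖Σ_{n∈R} b(n₁n)ρ(n)/n − Σ_{d₁d₂=n₁}(Σ_{u∈R} f(d₁u)ρ(u)/u)(Σ_{v∈R} g(d₂v)ρ(v)/v)‖
 ≤ (1+|ι₂|)(|ι₃|+|ι₄|)·16(Σ_{m<⌈P⌉} 1/m)⁴/D⁴ · τ₂(n₁)`, `R = {1 ≤ n < ⌈P⌉ : (n,𝔮) = 1}`.
[cite: Zhang2022LandauSiegel, App. B, proof of Lemma 15.1, pp.106–107] -/
theorem bcoef_weight_reduction_at (ρ : ℕ → ℂ)
    (hρmul : ∀ u v : ℕ, Nat.Coprime u v → ρ (u * v) = ρ u * ρ v)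
    (hρle : ∀ n : ℕ, ‖ρ n‖ ≤ n.divisors.card)
    (hD3 : 3 ≤ ell D) (hD1 : 1 ≤ D) (n₁ : ℕ) (hn₁ : n₁ ∈ nset (frakq D)) :
    ‖(∑ n ∈ (Finset.Ico 1 ⌈bigP D⌉₊).filter (fun n => Nat.Coprime n (frakq D)),
        bcoef D (n₁ * n) * ρ n / (n : ℂ)) -
      ∑ p ∈ n₁.divisorsAntidiagonal,
        (∑ u ∈ (Finset.Ico 1 ⌈bigP D⌉₊).filter (fun n => Nat.Coprime n (frakq D)),
          ((if ((p.1 * u : ℕ) : ℝ) < bigP D ^ (1 / 2 : ℝ) then vk1 D (p.1 * u) else 0) +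
              iota2 * vk2 D (p.1 * u)) * ρ u / (u : ℂ)) *
        (∑ v ∈ (Finset.Ico 1 ⌈bigP D⌉₊).filter (fun n => Nat.Coprime n (frakq D)),
          (conj iota3 * vk3 D (p.2 * v) + conj iota4 * vk2 D (p.2 * v)) *
            ρ v / (v : ℂ))‖ ≤
      (1 + ‖iota2‖) * (‖iota3‖ + ‖iota4‖) *
        (16 * (∑ m ∈ Finset.Ico 1 ⌈bigP D⌉₊, (1 / (m : ℝ))) ^ 4 / (D : ℝ) ^ 4) *
        n₁.divisors.card := by
  set N : ℕ := ⌈bigP D⌉₊ with hN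
  set R : Finset ℕ := (Finset.Ico 1 N).filter (fun n => Nat.Coprime n (frakq D)) with hR
  set f : ℕ → ℂ := fun a => (if (a : ℝ) < bigP D ^ (1 / 2 : ℝ) then vk1 D a else 0) + iota2 * vk2 D a
    with hf
  set g : ℕ → ℂ := fun a => conj iota3 * vk3 D a + conj iota4 * vk2 D a with hg
  have hℓ2 : 2 ≤ Real.log D := by rw [← ell]; linarith
  have hR0 : 0 ∉ R := by simp [hR]
  have hRsub : R ⊆ Finset.Ico 1 N := Finset.filter_subset _ _
  have hRcop : ∀ u ∈ R, Nat.Coprime u (frakq D) := fun u hu => (Finset.mem_filter.mp hu).2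
  have hRdiv : ∀ n ∈ R, ∀ d : ℕ, d ∣ n → d ∈ R := by
    intro n hn d hd
    rw [hR, Finset.mem_filter, Finset.mem_Ico] at hn ⊢
    have hn0 : n ≠ 0 := by omega
    exact ⟨⟨Nat.pos_of_ne_zero (ne_zero_of_dvd_ne_zero hn0 hd),
      lt_of_le_of_lt (Nat.le_of_dvd (by omega) hd) hn.1.2⟩, hn.2.coprime_dvd_left hd⟩
  have hvanish : ∀ x ∈ n₁.divisorsAntidiagonal, ∀ u v : ℕ, N ≤ u * v →
      f (x.1 * u) * g (x.2 * v) = 0 := by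
    intro x hx u v huv
    obtain ⟨hx12, hn10⟩ := Nat.mem_divisorsAntidiagonal.mp hx
    have hx1 : 1 ≤ x.1 := Nat.pos_of_ne_zero (left_ne_zero_of_mul (hx12 ▸ hn10))
    have hx2 : 1 ≤ x.2 := Nat.pos_of_ne_zero (right_ne_zero_of_mul (hx12 ▸ hn10))
    by_contra hne
    have hfne : f (x.1 * u) ≠ 0 := left_ne_zero_of_mul hne
    have hgne : g (x.2 * v) ≠ 0 := right_ne_zero_of_mul hne
    have hu : (u : ℝ) < bigP D ^ (1 / 2 : ℝ) := by
      have := lt_sqrtP_of_ne_zero hfne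
      push_cast at this
      have h1 : (u : ℝ) ≤ (x.1 : ℝ) * u := le_mul_of_one_le_left (Nat.cast_nonneg _) (by exact_mod_cast hx1)
      linarith
    have hv : (v : ℝ) < max (P2 D) (P3 D) := by
      have := lt_max_of_ne_zero hgne
      push_cast at this
      have h1 : (v : ℝ) ≤ (x.2 : ℝ) * v := le_mul_of_one_le_left (Nat.cast_nonneg _) (by exact_mod_cast hx2)
      linarith
    have huv' : (u : ℝ) * v < bigP D := by
      have h0u : (0 : ℝ) ≤ u := Nat.cast_nonneg _
      have h0m : (0 : ℝ) ≤ max (P2 D) (P3 D) :=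
        le_trans (by rw [P3, bigP]; exact Real.rpow_nonneg (Real.exp_pos _).le _) (le_max_right _ _)
      calc (u : ℝ) * v ≤ bigP D ^ (1 / 2 : ℝ) * max (P2 D) (P3 D) :=
            mul_le_mul hu.le hv.le (Nat.cast_nonneg _) (Real.rpow_nonneg (Real.exp_pos _).le _)
        _ < bigP D := sqrtP_mul_max_lt_bigP hD3
    have : ((u * v : ℕ) : ℝ) < N := by
      push_cast; exact lt_of_lt_of_le huv' (Nat.le_ceil _)
    exact absurd (by exact_mod_cast this : u * v < N) (not_lt.mpr huv)
  have hL : (∑ n ∈ R, bcoef D (n₁ * n) * ρ n / (n : ℂ)) =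
      ∑ x ∈ n₁.divisorsAntidiagonal, ∑ u ∈ R, ∑ v ∈ R,
        f (x.1 * u) * g (x.2 * v) * ρ (u * v) / ((u : ℂ) * v) := by
    have e1 : ∀ n ∈ R, bcoef D (n₁ * n) * ρ n / (n : ℂ) =
        ∑ x ∈ n₁.divisorsAntidiagonal, ∑ y ∈ n.divisorsAntidiagonal,
          f (x.1 * y.1) * g (x.2 * y.2) * ρ (y.1 * y.2) / ((y.1 : ℂ) * y.2) := by
      intro n hn
      have hcop : Nat.Coprime n₁ n := by
        refine Nat.coprime_of_dvd fun k hk hk₁ hkn => ?_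
        have hkq : k ∣ frakq D := hn₁.2 k hk hk₁
        have : k ∣ Nat.gcd n (frakq D) := Nat.dvd_gcd hkn hkq
        rw [(hRcop n hn).gcd_eq_one] at this
        exact hk.not_dvd_one this
      have hb : bcoef D (n₁ * n) = ∑ w ∈ (n₁ * n).divisorsAntidiagonal, f w.1 * g w.2 := by
        rw [bcoef]
      rw [hb, Literature.NumberTheory.EllipticCurves.ModularForms.UpperHecke.sum_divisorsAntidiagonal_mul_of_coprime
        hcop (fun a b => f a * g b), Finset.sum_mul,
        Finset.sum_div]
      refine Finset.sum_congr rfl fun x _ => ?_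
      rw [Finset.sum_mul, Finset.sum_div]
      refine Finset.sum_congr rfl fun y hy => ?_
      rw [(Nat.mem_divisorsAntidiagonal.mp hy).1, ← Nat.cast_mul, (Nat.mem_divisorsAntidiagonal.mp hy).1]
    rw [Finset.sum_congr rfl e1, Finset.sum_comm]
    refine Finset.sum_congr rfl fun x hx => ?_
    rw [sum_sum_divisorsAntidiagonal_eq R hR0 hRdiv
      (fun y : ℕ × ℕ => f (x.1 * y.1) * g (x.2 * y.2) * ρ (y.1 * y.2) / ((y.1 : ℂ) * y.2)),
      ← Finset.sum_product']
    refine Finset.sum_subset (Finset.filter_subset _ _) fun y hy hy' => ?_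
    rw [Finset.mem_product] at hy
    have hge : N ≤ y.1 * y.2 := by
      by_contra hlt
      rw [not_le] at hlt
      apply hy'
      rw [Finset.mem_filter]
      refine ⟨Finset.mem_product.mpr hy, ?_⟩
      rw [hR, Finset.mem_filter, Finset.mem_Ico]
      have h1 := Finset.mem_filter.mp hy.1
      have h2 := Finset.mem_filter.mp hy.2
      rw [Finset.mem_Ico] at h1 h2
      exact ⟨⟨Nat.one_le_iff_ne_zero.mpr (mul_ne_zero (by omega) (by omega)), hlt⟩,
        Nat.Coprime.mul_left h1.2 h2.2⟩
    rw [hvanish x hx y.1 y.2 hge]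
    simp
  have hRHS : (∑ x ∈ n₁.divisorsAntidiagonal,
      (∑ u ∈ R, f (x.1 * u) * ρ u / (u : ℂ)) * (∑ v ∈ R, g (x.2 * v) * ρ v / (v : ℂ))) =
      ∑ x ∈ n₁.divisorsAntidiagonal, ∑ u ∈ R, ∑ v ∈ R,
        f (x.1 * u) * g (x.2 * v) * (ρ u * ρ v) / ((u : ℂ) * v) := by
    refine Finset.sum_congr rfl fun x _ => ?_
    rw [Finset.sum_mul_sum]
    refine Finset.sum_congr rfl fun u hu => Finset.sum_congr rfl fun v hv => ?_
    have hu0 : (u : ℂ) ≠ 0 := by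
      have := hRsub hu; rw [Finset.mem_Ico] at this; exact_mod_cast (show u ≠ 0 by omega)
    have hv0 : (v : ℂ) ≠ 0 := by
      have := hRsub hv; rw [Finset.mem_Ico] at this; exact_mod_cast (show v ≠ 0 by omega)
    rw [div_mul_div_comm]
    ring
  have hdiff : (∑ n ∈ R, bcoef D (n₁ * n) * ρ n / (n : ℂ)) -
      (∑ x ∈ n₁.divisorsAntidiagonal,
        (∑ u ∈ R, f (x.1 * u) * ρ u / (u : ℂ)) * (∑ v ∈ R, g (x.2 * v) * ρ v / (v : ℂ))) =
      ∑ x ∈ n₁.divisorsAntidiagonal, ∑ u ∈ R, ∑ v ∈ R,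
        f (x.1 * u) * g (x.2 * v) * (ρ (u * v) - ρ u * ρ v) / ((u : ℂ) * v) := by
    rw [hL, hRHS, ← Finset.sum_sub_distrib]
    refine Finset.sum_congr rfl fun x _ => ?_
    rw [← Finset.sum_sub_distrib]
    refine Finset.sum_congr rfl fun u _ => ?_
    rw [← Finset.sum_sub_distrib]
    refine Finset.sum_congr rfl fun v _ => ?_
    ring
  have hC0 : ∀ x : ℕ × ℕ, ∀ u v : ℕ, ‖f (x.1 * u) * g (x.2 * v)‖ ≤ (1 + ‖iota2‖) * (‖iota3‖ + ‖iota4‖) := by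
    intro x u v
    rw [norm_mul]
    refine mul_le_mul ?_ ?_ (norm_nonneg _) (by positivity)
    · refine (norm_add_le _ _).trans (add_le_add ?_ ?_)
      · split_ifs
        · exact norm_vk1_le hℓ2 _
        · simp
      · rw [norm_mul]; exact mul_le_of_le_one_right (norm_nonneg _) (norm_vk2_le hℓ2 _)
    · refine (norm_add_le _ _).trans (add_le_add ?_ ?_)
      · rw [norm_mul, Complex.norm_conj]
        exact mul_le_of_le_one_right (norm_nonneg _) (norm_vk3_le hℓ2 _)
      · rw [norm_mul, Complex.norm_conj]
        exact mul_le_of_le_one_right (norm_nonneg _) (norm_vk2_le hℓ2 _)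
  have hterm : ∀ x : ℕ × ℕ, ∀ u ∈ R, ∀ v ∈ R,
      ‖f (x.1 * u) * g (x.2 * v) * (ρ (u * v) - ρ u * ρ v) / ((u : ℂ) * v)‖ ≤
        (1 + ‖iota2‖) * (‖iota3‖ + ‖iota4‖) *
          (if Nat.Coprime u v then (0 : ℝ)
            else 2 * ((u.divisors.card : ℝ) * v.divisors.card) / ((u : ℝ) * v)) := by
    intro x u hu v hv
    split_ifs with huv
    · rw [hρmul u v huv, sub_self, mul_zero, zero_div, norm_zero, mul_zero]
    · have hu1 := hRsub hu
      have hv1 := hRsub hv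
      rw [Finset.mem_Ico] at hu1 hv1
      have hu0 : (0 : ℝ) < u := by exact_mod_cast hu1.1
      have hv0 : (0 : ℝ) < v := by exact_mod_cast hv1.1
      have hden : ‖(u : ℂ) * (v : ℂ)‖ = (u : ℝ) * v := by
        rw [norm_mul, Complex.norm_natCast, Complex.norm_natCast]
      rw [norm_div, norm_mul, hden, mul_div_assoc]
      refine mul_le_mul (hC0 x u v) ?_ (by positivity) (by positivity)
      exact div_le_div_of_nonneg_right (norm_weight_mul_sub_le ρ hρle u v) (by positivity)
  rw [hdiff]
  have hcard : (n₁.divisorsAntidiagonal.card : ℝ) = n₁.divisors.card := by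
    rw [← Nat.map_div_right_divisors, Finset.card_map]
  calc ‖∑ x ∈ n₁.divisorsAntidiagonal, ∑ u ∈ R, ∑ v ∈ R,
          f (x.1 * u) * g (x.2 * v) * (ρ (u * v) - ρ u * ρ v) / ((u : ℂ) * v)‖
      ≤ ∑ x ∈ n₁.divisorsAntidiagonal, ∑ u ∈ R, ∑ v ∈ R,
          ‖f (x.1 * u) * g (x.2 * v) * (ρ (u * v) - ρ u * ρ v) / ((u : ℂ) * v)‖ := by
        refine (norm_sum_le _ _).trans (Finset.sum_le_sum fun x _ => ?_)
        exact (norm_sum_le _ _).trans (Finset.sum_le_sum fun u _ => norm_sum_le _ _)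
    _ ≤ ∑ x ∈ n₁.divisorsAntidiagonal, ∑ u ∈ R, ∑ v ∈ R,
          (1 + ‖iota2‖) * (‖iota3‖ + ‖iota4‖) *
            (if Nat.Coprime u v then (0 : ℝ)
              else 2 * ((u.divisors.card : ℝ) * v.divisors.card) / ((u : ℝ) * v)) :=
        Finset.sum_le_sum fun x _ => Finset.sum_le_sum fun u hu =>
          Finset.sum_le_sum fun v hv => hterm x u hu v hv
    _ = (n₁.divisorsAntidiagonal.card : ℝ) * ∑ u ∈ R, ∑ v ∈ R,
          (1 + ‖iota2‖) * (‖iota3‖ + ‖iota4‖) *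
            (if Nat.Coprime u v then (0 : ℝ)
              else 2 * ((u.divisors.card : ℝ) * v.divisors.card) / ((u : ℝ) * v)) := by
        rw [Finset.sum_const, nsmul_eq_mul]
    _ = (n₁.divisorsAntidiagonal.card : ℝ) * ((1 + ‖iota2‖) * (‖iota3‖ + ‖iota4‖) *
          ∑ u ∈ R, ∑ v ∈ R, (if Nat.Coprime u v then (0 : ℝ)
              else 2 * ((u.divisors.card : ℝ) * v.divisors.card) / ((u : ℝ) * v))) := by
        congr 1
        rw [Finset.mul_sum]
        refine Finset.sum_congr rfl fun u _ => ?_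
        rw [Finset.mul_sum]
    _ ≤ (n₁.divisors.card : ℝ) * ((1 + ‖iota2‖) * (‖iota3‖ + ‖iota4‖) *
          (16 * (∑ m ∈ Finset.Ico 1 N, (1 / (m : ℝ))) ^ 4 / (D : ℝ) ^ 4)) := by
        rw [hcard]
        refine mul_le_mul_of_nonneg_left ?_ (Nat.cast_nonneg _)
        exact mul_le_mul_of_nonneg_left (common_prime_tail_le hD1 hRsub hRcop) (by positivity)
    _ = (1 + ‖iota2‖) * (‖iota3‖ + ‖iota4‖) *
          (16 * (∑ m ∈ Finset.Ico 1 N, (1 / (m : ℝ))) ^ 4 / (D : ℝ) ^ 4) * n₁.divisors.card := by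
        ring

end Reduction

end Literature.NumberTheory.LFunctions.Zhang2022.Skeleton
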